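import Mathlib
import HarnessLib
import Summits.HubbardSuperconductivity.HubbardSuperconductivity.Theorems.KLProgrammePerturbedFermiCurveCooperArc
import Summits.HubbardSuperconductivity.HubbardSuperconductivity.Theorems.KLProgrammeKLRegimeTwoPointLimitShellCountTools

/-!
# Route `KLProgramme` — ENGINE child (stmt-HubbardSuperconductivity-20437 `KLRegimeEngineV17F2`): AT MOST THREE intersection points of the frame's Fermi curve
# with a small translate, per period (step (T2), Cooper regime; frame analogue of p1b's `klcc_zeros_card_le_three` with constants from `FrameOK` (i)/(ii) only;
# design note HOME/hubbard-kl-k3c2-p2/TWO-SHELL-FRAME-PORT.md §6 — resolves RISK-1: the count is Gauss-map based, not algebraic)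

Cell `gate-hubbard-kl`, seat hubbard-kl-k3c2-p2 g15.  Frame `δ_K = −K.eval`, `E = ε₀ + δ_K`, `GeomConstants (frameLevel μ K) Kc r₀ g₀ w`, a `2π`-periodic root selection `u`
of the level-`ν` curve (`|ν − μ| < r₀`, C⁰/C¹ binders `κ₀`, `κ₁ < Dt_min`), transfer `v = r·dir ψ`, `0 < r`, `Kc·r/(Dt_min − κ₁) ≤ s < 1`.  GIVEN a derivative `G′` of
`G(θ) = E(p(θ) − v)` with the SLOPE BOUND `2λ ≤ |G′(θ)|` on the arcs `|α(θ) − ψ − π/2 − kπ| ≤ (π/2)s` (supplied in the Cooper regime by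
`transversality_alternative_of_geomConstants` + `abs_transLevel_le_on_arc`), **`zeros_card_le_three_of_geomConstants`**: on every period `[θ₀, θ₀ + 2π]` the
equation `E(p(z) − v) = ν` has at most THREE solutions.  Proof = p1b's: a zero has `|cos(α(z) − ψ)| ≤ s/…` (`abs_cos_normalAngle_sub_le_of_zero`) so `α(z)` is
within `(π/2)s` of `ψ + π/2 + kπ` (Jordan, `klcc_exists_int_abs_sub_mul_pi_le`); two zeros with the same label bound an arc where `|G′| ≥ 2λ` — contradiction
(`mul_sub_le_abs_sub_of_le_abs_deriv`); `α` is strictly increasing (`normalAngleFn_sub_ge_of_geomConstants`) with `α(θ₀ + 2π) = α(θ₀) + 2π`, so the labels of a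
period lie in an interval of length `2 + s < 3` (`klsk_finite_ncard_le_of_separated`).
Everything is PROVED; no definitions, no named facts; nothing asserts any stub or superconductivity.
References: DECOMP App. E Lemma E.1; FST II App. B [cite: FeldmanSalmhoferTrubowitz1998]; BGM 2006 §2.4 [cite: BenfattoGiulianiMastropietro2006].
-/

noncomputable section

namespace Summit.HubbardSuperconductivity.HubbardSuperconductivity.Theorems.PerturbedFermiCurve

set_option linter.dupNamespace false -- summit = problem name (single-conjunct summit), D-0017

open Real Set
open Literature.MathematicalPhysics.QuantumLattice Literature.MathematicalPhysics.QuantumLattice.BandSectorCounting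
open Literature.MathematicalPhysics.QuantumLattice.FermiRG
open Summit.HubbardSuperconductivity.HubbardSuperconductivity.Theorems.DispersionFlow
open Summit.HubbardSuperconductivity.HubbardSuperconductivity.Theorems.KLRegimeSplit

section Root

variable {a b : ℝ} (B : BandBounds a b) {K : TrigPolyC4v} {κ₀ κ₁ ν : ℝ}
  (hδ : ∀ k : Fin 2 → ℝ, (∀ i, |k i| ≤ π) → |(fun k : Fin 2 → ℝ => -K.eval k) k| ≤ κ₀) (hlo : a ≤ ν - κ₀) (hhi : ν + κ₀ ≤ b)
  (hκ : ∀ k : Fin 2 → ℝ, (∀ i, |k i| ≤ π) → ‖fderiv ℝ (fun k : Fin 2 → ℝ => -K.eval k) k‖ ≤ κ₁) (hκ₁ : κ₁ < B.Dtmin)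
  {u : ℝ → ℝ} (hu : ∀ θ, IsBandFermiRadius (ν - (fun k : Fin 2 → ℝ => -K.eval k) (u θ • dir θ)) θ (u θ)) (hper : Function.Periodic u (2 * π))
  {μ Kc r₀ g₀ w : ℝ} (hG : GeomConstants (frameLevel μ K) Kc r₀ g₀ w) (hν : |ν - μ| < r₀)
include B hδ hlo hhi hκ hκ₁ hu hper hG hν

/-- **At most three intersection points near the Cooper point, on the frame's Fermi curve** (see the module docstring).
[cite: FeldmanSalmhoferTrubowitz1998, App. B] -/
theorem zeros_card_le_three_of_geomConstants {r ψ s lam θ₀ : ℝ} (hr : 0 < r) (hs0 : 0 ≤ s) (hs1 : s < 1)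
    (hrs : Kc * r / (B.Dtmin - κ₁) ≤ s) (hlam : 0 < lam) (G' : ℝ → ℝ)
    (hGd : ∀ t, HasDerivAt (fun t => sqDispersion (u t • dir t - r • dir ψ) + -K.eval (u t • dir t - r • dir ψ)) (G' t) t)
    (hslope : ∀ (θ : ℝ) (k : ℤ), |(θ - Real.arctan (deriv u θ / u θ)) - ψ - π / 2 - k * π| ≤ π / 2 * s → 2 * lam ≤ |G' θ|) :
    ∃ Z : Finset ℝ, Z.card ≤ 3 ∧
      ∀ z ∈ Icc θ₀ (θ₀ + 2 * π), sqDispersion (u z • dir z - r • dir ψ) + -K.eval (u z • dir z - r • dir ψ) = ν → z ∈ Z := by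
  classical
  have hπ := Real.pi_pos
  set α : ℝ → ℝ := fun θ => θ - Real.arctan (deriv u θ / u θ) with hα
  set G : ℝ → ℝ := fun t => sqDispersion (u t • dir t - r • dir ψ) + -K.eval (u t • dir t - r • dir ψ) with hGdef
  -- `α` is strictly increasing and `α(θ + 2π) = α(θ) + 2π`
  have hsq0 := abs_apply_le_pi_of_isBandFermiRadius (hu θ₀)
  have hκ₁0 : 0 ≤ κ₁ := le_trans (norm_nonneg _) (hκ _ hsq0)
  have hc : 0 < B.umin * w / (4 + κ₁) := by have := B.umin_pos; have := hG.wmin_pos; positivity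
  have hmono : StrictMono α := by
    intro x y hxy
    have h := normalAngleFn_sub_ge_of_geomConstants B hδ hlo hhi hκ hκ₁ hu hG hν hxy.le
    have : 0 < B.umin * w / (4 + κ₁) * (y - x) := mul_pos hc (by linarith)
    show α x < α y
    simp only [hα]; linarith
  have hα2π : α (θ₀ + 2 * π) = α θ₀ + 2 * π := by
    have h := normalAngleFn_add_int_mul_two_pi hper θ₀ 1
    simp only [Int.cast_one, one_mul] at h
    simpa [hα] using h
  -- the integer label of an angle (Jordan)
  have hk : ∀ z : ℝ, ∃ k : ℤ, |α z - ψ - π / 2 - k * π| ≤ π / 2 * |Real.cos (α z - ψ)| := by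
    intro z
    obtain ⟨k, hk⟩ := klcc_exists_int_abs_sub_mul_pi_le (α z - ψ - π / 2)
    refine ⟨k, ?_⟩
    rwa [Real.sin_sub_pi_div_two, abs_neg] at hk
  choose kOf hkOf using hk
  set ZS : Set ℝ := {z ∈ Icc θ₀ (θ₀ + 2 * π) | G z = ν} with hZS
  -- Step 1–2: at a zero, `α(z)` is within `(π/2)s` of `ψ + π/2 + kπ`
  have harc : ∀ z ∈ ZS, |α z - ψ - π / 2 - kOf z * π| ≤ π / 2 * s := by
    intro z hz
    have hcos : |Real.cos (α z - ψ)| ≤ s :=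
      (abs_cos_normalAngle_sub_le_of_zero B hδ hlo hhi hκ hκ₁ hu hG hr hz.2).trans hrs
    calc |α z - ψ - π / 2 - kOf z * π| ≤ π / 2 * |Real.cos (α z - ψ)| := hkOf z
      _ ≤ π / 2 * s := by gcongr
  -- Step 3: the label is injective on the zero set (two zeros with the same label bound an arc of slope `≥ 2λ`)
  have hinj : InjOn (fun z => ((kOf z : ℤ) : ℝ)) ZS := by
    intro z hz z' hz' hzz'
    have hzz'' : ((kOf z : ℤ) : ℝ) = ((kOf z' : ℤ) : ℝ) := hzz'
    have hkk : kOf z = kOf z' := by exact_mod_cast hzz''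
    by_contra hne
    have key : ∀ x ∈ ZS, ∀ x' ∈ ZS, x < x' → kOf x = kOf x' → False := by
      intro x hx x' hx' hxx' hk'
      have hder : ∀ t ∈ Icc x x', 2 * lam ≤ |G' t| := by
        intro t ht
        refine hslope t (kOf x) ?_
        have ha := harc x hx
        have hb := harc x' hx'
        rw [← hk'] at hb
        have hm1 : α x ≤ α t := hmono.monotone ht.1
        have hm2 : α t ≤ α x' := hmono.monotone ht.2
        have ha' := abs_le.1 ha
        have hb' := abs_le.1 hb
        rw [abs_le]
        constructor <;> linarith [ha'.1, ha'.2, hb'.1, hb'.2]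
      have hmvt := mul_sub_le_abs_sub_of_le_abs_deriv hGd hxx'.le (by linarith) hder
      have h0 : G x' - G x = 0 := by rw [hx.2, hx'.2, sub_self]
      have h0' : sqDispersion (u x' • dir x' - r • dir ψ) + -K.eval (u x' • dir x' - r • dir ψ) -
          (sqDispersion (u x • dir x - r • dir ψ) + -K.eval (u x • dir x - r • dir ψ)) = 0 := h0
      rw [h0', abs_zero] at hmvt
      nlinarith
    rcases lt_or_gt_of_ne hne with hlt | hgt
    · exact key z hz z' hz' hlt hkk
    · exact key z' hz' z hz hgt hkk.symm
  -- Step 4: the labels lie in an interval of length `2 + s`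
  set L := (α θ₀ - ψ - π / 2 - π / 2 * s) / π with hL
  set U := (α θ₀ + 2 * π - ψ - π / 2 + π / 2 * s) / π with hU
  have hUL : U - L = 2 + s := by rw [hU, hL]; field_simp; ring
  have hLU : L ≤ U := by linarith
  have himg : (fun z => ((kOf z : ℤ) : ℝ)) '' ZS ⊆ Icc L U := by
    rintro x ⟨z, hz, rfl⟩
    have ha := abs_le.1 (harc z hz)
    have hm1 : α θ₀ ≤ α z := hmono.monotone hz.1.1
    have hm2 : α z ≤ α θ₀ + 2 * π := by
      have := hmono.monotone hz.1.2
      rwa [hα2π] at this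
    constructor
    · rw [hL, div_le_iff₀ hπ]; linarith [ha.1, ha.2]
    · rw [hU, le_div_iff₀ hπ]; linarith [ha.1, ha.2]
  -- Step 5: distinct labels are integers, hence `1`-separated: at most `3 + s < 4` of them
  have hsep : ∀ x ∈ (fun z => ((kOf z : ℤ) : ℝ)) '' ZS, ∀ x' ∈ (fun z => ((kOf z : ℤ) : ℝ)) '' ZS,
      x < x' → (1 : ℝ) ≤ x' - x := by
    rintro x ⟨z, -, rfl⟩ x' ⟨z', -, rfl⟩ hlt
    have hlt' : ((kOf z : ℤ) : ℝ) < ((kOf z' : ℤ) : ℝ) := hlt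
    have hzz : kOf z < kOf z' := by exact_mod_cast hlt'
    have hzz1 : kOf z + 1 ≤ kOf z' := hzz
    have hcast : ((kOf z : ℤ) : ℝ) + 1 ≤ ((kOf z' : ℤ) : ℝ) := by exact_mod_cast hzz1
    show (1 : ℝ) ≤ ((kOf z' : ℤ) : ℝ) - ((kOf z : ℤ) : ℝ)
    linarith
  obtain ⟨hKfin, hKcard⟩ := klsk_finite_ncard_le_of_separated one_pos hLU himg hsep
  rw [hUL, div_one] at hKcard
  have hZSfin : ZS.Finite := Set.Finite.of_finite_image hKfin hinj
  have hncard : ZS.ncard = ((fun z => ((kOf z : ℤ) : ℝ)) '' ZS).ncard := (hinj.ncard_image).symm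
  have hle3 : ZS.ncard ≤ 3 := by
    have h3 : (ZS.ncard : ℝ) ≤ 2 + s + 1 := by rw [hncard]; exact hKcard
    have h4 : (ZS.ncard : ℝ) < 4 := by linarith
    have h5 : ZS.ncard < 4 := by exact_mod_cast h4
    omega
  refine ⟨hZSfin.toFinset, ?_, ?_⟩
  · rw [← Set.ncard_eq_toFinset_card ZS hZSfin]; exact hle3
  · intro z hz hGz
    rw [Set.Finite.mem_toFinset]
    exact ⟨hz, hGz⟩

end Root

end Summit.HubbardSuperconductivity.HubbardSuperconductivity.Theorems.PerturbedFermiCurve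

end
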